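import Summits.NavierStokesRegularity.NavierStokesRegularity.Theorems.HodographBetchovFastClassSqueezeStreamStrainDissipative
import Summits.NavierStokesRegularity.NavierStokesRegularity.Theorems.HodographBetchovFastClassSqueezeStreamStrainWeight

/-!
# Crux `HodographBetchov.FastClassSqueeze` — the VELOCITY-TRUNCATED enstrophy ledger at a fixed time

Helper file for the crux item stmt-NavierStokesRegularity-15832 (`FastClassSqueeze`, route
`HodographBetchov` of `NavierStokesRegularity`). The route's bridge (`classLedger_slice`, crux
`ClassBudgetsRegularise`) bounds the enstrophy growth by the SLOW-CLASS PRODUCTION `∫_{‖v‖≤l} P`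
plus a fast-class weighted term. This file removes the slow-class production altogether
(`truncatedLedger_slice`): with a smooth cut-off `χ` of the speed (`χ = 1` on `‖v‖ ≤ l`, `= 0` on
`‖v‖ ≥ 2l`), `∫ P = ∫ χP + ∫ (1−χ)P`; the cut-off production is integrated by parts
(`integral_cutoff_mul_production_eq`): `∫ χ P = −∫ χ⟪v, ∇ω ω⟫ − ∫ ⟪v,ω⟫ χ' 2⟪v, ∇v ω⟫`; the first
term is paid by the dissipation (`dissipative_term_le`), the second (SHELL) term and Betchov's fast
term `∫ (1−χ)(P − 4 det ∇v)` (null Lagrangian `∫ (1−χ(‖v‖²)) det ∇v = 0`) live on the fast class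
and see only the STREAM-DIRECTIONAL STRAIN (`weighted_term_le`). Result: for a majorant `m ≥ 0`,
`‖S(x) v(x)‖ ≤ m(x) ‖v(x)‖` for `l < ‖v(x)‖`, `∫_{l<‖v‖} m^p < ∞`, `p > 3/2`,

  `∫ Σᵢ ⟪∂ᵢv, ∂ᵢW⟫ ≤ C_l ∫|∇v|²_F + κ(θ, ν) (2 (c ‖m 1_F‖_p) K_S^{2(1−θ)})^{1/θ} ∫|∇v|²_F`,

`C_l = 108 (‖curl‖² + 1) ‖curl‖² l² / ν`, `c = D ‖curl‖² + 1`, `θ = 1 − 3/(2p)` — NO slow-class term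
(the velocity-truncated, stream-directional form of Beirão da Veiga's `∇u ∈ L^p_t L^q_x` criterion).

References: E. Miller, Arch. Ration. Mech. Anal. 235 (2020), Thm. 1.1 / Lemma 5.1 / Thm. 1.3;
R. Betchov, J. Fluid Mech. 1 (1956); H. Beirão da Veiga, Chinese Ann. Math. Ser. B 16 (1995).
-/

noncomputable section

open MeasureTheory Set Function Filter Topology InnerProductSpace
open scoped ENNReal NNReal ContDiff RealInnerProductSpace Laplacian

-- the summit and its single sub-problem share the name (CONVENTIONS §1), as in every Theorems file
set_option linter.dupNamespace false

namespace Summit.NavierStokesRegularity.NavierStokesRegularity.Theorems.FastClassSqueeze.StreamStrain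

open Literature.Analysis Literature.Analysis.FluidPDE
open Summit.NavierStokesRegularity.NavierStokesRegularity.Theorems.ClassBudgetsRegularise

/-- **Derivative bound for a cut-off flat near the origin**: if `χ' = 0` on `|s| ≤ l²` and
`|χ'(s)| |s| ≤ D`, then `|χ'| ≤ D / l²` everywhere. The registered helper stub of this file. [folklore] -/
theorem abs_deriv_cutoff_le : ∀ (χ : ℝ → ℝ) (l D : ℝ), 0 < l → 0 ≤ D →
    (∀ s, |s| ≤ l ^ 2 → deriv χ s = 0) → (∀ s, |deriv χ s| * |s| ≤ D) → ∀ s, |deriv χ s| ≤ D / l ^ 2 := by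
  intro χ l D hl hD hχd0 hχD s
  by_cases hs : |s| ≤ l ^ 2
  · rw [hχd0 s hs, abs_zero]; positivity
  · rw [not_le] at hs
    rw [le_div_iff₀ (sq_pos_of_pos hl)]
    calc |deriv χ s| * l ^ 2 ≤ |deriv χ s| * |s| := mul_le_mul_of_nonneg_left hs.le (abs_nonneg _)
      _ ≤ D := hχD s

set_option maxHeartbeats 400000 in
/-- **The velocity-truncated enstrophy ledger at a fixed time.** Hypotheses: one time slice
`v = u(t)`, `W = ∂ₜu(t)`, `q = p(t)` of a classical solution in Tao's class (as in
`ClassBudgetsRegularise.classLedger_slice`, with `v ∈ C^∞`), a level `l > 0`, a smooth cut-off `χ`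
with `0 ≤ χ ≤ 1`, `χ = 1` and `χ' = 0` on `|s| ≤ l²`, `χ = 0` on `|s| ≥ 4l²`, `|χ'(s)| |s| ≤ D`,
and a majorant `m ≥ 0` of the stream-directional strain on the fast class, `‖S(x) v(x)‖ ≤ m(x)‖v(x)‖`
for `l < ‖v(x)‖`, `∫_{l<‖v‖} m^p < ∞`, `p > 3/2`. Conclusion: the slow-class-free ledger of the
module docstring. [cite: Miller2019, Thm 1.1 (proof of Thm 5.2) and Lemma 5.1] -/
theorem truncatedLedger_slice {ν : ℝ} (hν : 0 < ν)
    {v W : EuclideanSpace ℝ (Fin 3) → EuclideanSpace ℝ (Fin 3)} {q : EuclideanSpace ℝ (Fin 3) → ℝ}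
    (hv : ContDiff ℝ ∞ v) (hW : ContDiff ℝ 1 W) (hq : ContDiff ℝ 1 q)
    (hmom : ∀ x, W x + FluidPDE.convect v v x = ν • (Δ v) x - gradient q x)
    (hdiv : VectorCalculus.IsDivFree v) {B : ℝ} (hB : ∀ x, ‖v x‖ ≤ B)
    {K : ℝ} (hK : ∀ x, ‖fderiv ℝ v x‖ ≤ K)
    (hv1 : ∫⁻ x, ‖iteratedFDeriv ℝ 1 v x‖ₑ ^ 2 < ⊤) (hv2 : ∫⁻ x, ‖iteratedFDeriv ℝ 2 v x‖ₑ ^ 2 < ⊤)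
    (hv3 : ∫⁻ x, ‖iteratedFDeriv ℝ 3 v x‖ₑ ^ 2 < ⊤)
    (hW0 : ∫⁻ x, ‖W x‖ₑ ^ 2 < ⊤) (hW1 : ∫⁻ x, ‖iteratedFDeriv ℝ 1 W x‖ₑ ^ 2 < ⊤)
    (hq0 : ∫⁻ x, ‖q x‖ₑ ^ 2 < ⊤) (hq1 : ∫⁻ x, ‖iteratedFDeriv ℝ 1 q x‖ₑ ^ 2 < ⊤)
    {l : ℝ} (hl : 0 < l)
    {χ : ℝ → ℝ} (hχ : ContDiff ℝ ∞ χ) (hχ01 : ∀ s, 0 ≤ χ s ∧ χ s ≤ 1)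
    (hχ1 : ∀ s, |s| ≤ l ^ 2 → χ s = 1) (hχd0 : ∀ s, |s| ≤ l ^ 2 → deriv χ s = 0)
    (hχ0 : ∀ s, 4 * l ^ 2 ≤ |s| → χ s = 0) {D : ℝ} (hD0 : 0 ≤ D)
    (hχD : ∀ s, |deriv χ s| * |s| ≤ D)
    {m : EuclideanSpace ℝ (Fin 3) → ℝ} (hm0 : ∀ x, 0 ≤ m x)
    (hdir : ∀ x, l < ‖v x‖ →
      ‖((1 / 2 : ℝ) • (fderiv ℝ v x + ContinuousLinearMap.adjoint (fderiv ℝ v x))) (v x)‖ ≤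
        m x * ‖v x‖)
    {p : ℝ} (hp : 3 / 2 < p)
    (hmp : ∫⁻ x in {x | l < ‖v x‖}, ENNReal.ofReal (m x) ^ p < ⊤) :
    ∫ x, ∑ i, ⟪fderiv ℝ v x (EuclideanSpace.basisFun (Fin 3) ℝ i),
        fderiv ℝ W x (EuclideanSpace.basisFun (Fin 3) ℝ i)⟫ ≤
      108 * (‖curlCLM‖ ^ 2 + 1) * ‖curlCLM‖ ^ 2 * l ^ 2 / ν * (∫ x, frobeniusNormSq (fderiv ℝ v x)) +
        (1 - 3 / (2 * p)) * (2 * (1 - (1 - 3 / (2 * p)))) ^ ((1 - (1 - 3 / (2 * p))) / (1 - 3 / (2 * p))) *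
          ν ^ (-((1 - (1 - 3 / (2 * p))) / (1 - 3 / (2 * p)))) *
          (2 * ((D * ‖curlCLM‖ ^ 2 + 1) *
              ((∫⁻ x in {x | l < ‖v x‖}, ENNReal.ofReal (m x) ^ p) ^ (1 / p)).toReal) *
            ((SNormLESNormFDerivOfEqConst (EuclideanSpace ℝ (Fin 3))
              (volume : Measure (EuclideanSpace ℝ (Fin 3))) 2 : ℝ) ^ (2 * (1 - (1 - 3 / (2 * p)))))) ^
            (1 / (1 - 3 / (2 * p))) *
          ∫ x, frobeniusNormSq (fderiv ℝ v x) := by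
  have hK0 : 0 ≤ K := (norm_nonneg _).trans (hK 0)
  have hv3' : ContDiff ℝ 3 v := hv.of_le (by norm_cast)
  have hv2' : ContDiff ℝ 2 v := hv.of_le (by norm_cast)
  have hv1' : ContDiff ℝ 1 v := hv.of_le (by norm_cast)
  have hdv : ∀ x, DifferentiableAt ℝ v x := fun x => (hv1'.differentiable one_ne_zero) x
  have hω1 : ContDiff ℝ 1 (curl v) := contDiff_curl (n := 1) (by exact_mod_cast hv2')
  have cv : Continuous v := hv.continuous
  have cDv : Continuous (fderiv ℝ v) := hv1'.continuous_fderiv one_ne_zero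
  have ccurl : Continuous (curl v) := hω1.continuous
  set cω : ℝ := ‖curlCLM‖ with hcω
  have hφ01 : ∀ x, 0 ≤ χ (‖v x‖ ^ 2) ∧ χ (‖v x‖ ^ 2) ≤ 1 := fun x => hχ01 _
  have hχD' : ∀ s, |deriv χ s| ≤ D / l ^ 2 := abs_deriv_cutoff_le χ l D hl hD0 hχd0 hχD
  have hχc' : Continuous (deriv χ) := hχ.continuous_deriv (by norm_cast)
  -- Step 1: the production identity
  have hprod := enstrophy_production_identity hv3' hW hq hmom hdiv hB hK hv1 hv2 hv3 hW0 hW1 hq0 hq1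
  have hDv_eq : ∀ x, ‖fderiv ℝ v x‖ = ‖iteratedFDeriv ℝ 1 v x‖ := fun x => by
    rw [← norm_iteratedFDeriv_fderiv, norm_iteratedFDeriv_zero]
  have l2Dv : ∫⁻ x, ‖fderiv ℝ v x‖ₑ ^ 2 < ⊤ :=
    lintegral_enorm_sq_lt_top_of_norm_le (fun x => (hDv_eq x).le) hv1
  have hfrob_int : Integrable (fun x => frobeniusNormSq (fderiv ℝ v x)) volume := by
    have lfrob : ∫⁻ x, ENNReal.ofReal (FluidPDE.frobeniusNormSq (fderiv ℝ v x)) < ⊤ :=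
      calc ∫⁻ x, ENNReal.ofReal (FluidPDE.frobeniusNormSq (fderiv ℝ v x))
          ≤ ∫⁻ x, 3 * ‖fderiv ℝ v x‖ₑ ^ 2 :=
            lintegral_mono fun x => ofReal_frobeniusNormSq_le_three_mul_enorm_sq _
        _ = 3 * ∫⁻ x, ‖fderiv ℝ v x‖ₑ ^ 2 := lintegral_const_mul' _ _ (by norm_num)
        _ < ⊤ := ENNReal.mul_lt_top (by norm_num) l2Dv
    exact integrable_of_continuous_of_nonneg (FluidPDE.continuous_frobeniusNormSq_fderiv hv (by simp))
      (fun x => FluidPDE.frobeniusNormSq_nonneg _) lfrob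
  have hω_le : ∀ x, ‖curl v x‖ ≤ cω * ‖fderiv ℝ v x‖ := fun x => norm_curl_le v x
  have hsq : ∀ x, ‖fderiv ℝ v x‖ ^ 2 ≤ frobeniusNormSq (fderiv ℝ v x) := fun x =>
    FluidPDE.sq_opNorm_le_frobeniusNormSq _
  have hω_sq : ∀ x, ‖curl v x‖ ^ 2 ≤ cω ^ 2 * frobeniusNormSq (fderiv ℝ v x) := fun x =>
    calc ‖curl v x‖ ^ 2 ≤ (cω * ‖fderiv ℝ v x‖) ^ 2 := pow_le_pow_left₀ (norm_nonneg _) (hω_le x) 2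
      _ = cω ^ 2 * ‖fderiv ℝ v x‖ ^ 2 := by ring
      _ ≤ cω ^ 2 * frobeniusNormSq (fderiv ℝ v x) := mul_le_mul_of_nonneg_left (hsq x) (sq_nonneg _)
  have cP : Continuous fun x => ⟪curl v x, fderiv ℝ v x (curl v x)⟫ := ccurl.inner (cDv.clm_apply ccurl)
  have cdet : Continuous fun x => (fderiv ℝ v x).det := ContinuousLinearMap.continuous_det.comp cDv
  have cfrob : Continuous fun x => frobeniusNormSq (fderiv ℝ v x) :=
    FluidPDE.continuous_frobeniusNormSq_fderiv hv (by simp)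
  have cφ : Continuous fun x => χ (‖v x‖ ^ 2) := hχ.continuous.comp (cv.norm.pow 2)
  have hdet_le : ∀ x, |(fderiv ℝ v x).det| ≤ (1 / 2) * K * frobeniusNormSq (fderiv ℝ v x) := fun x =>
    (abs_det_fderiv_le (hdv x)).trans (by
      gcongr
      · exact frobeniusNormSq_nonneg _
      · exact hK x)
  have hP_le : ∀ x, |⟪curl v x, fderiv ℝ v x (curl v x)⟫| ≤ cω ^ 2 * K * frobeniusNormSq (fderiv ℝ v x) := by
    intro x
    calc |⟪curl v x, fderiv ℝ v x (curl v x)⟫| ≤ ‖curl v x‖ * ‖fderiv ℝ v x (curl v x)‖ :=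
          abs_real_inner_le_norm _ _
      _ ≤ ‖curl v x‖ * (‖fderiv ℝ v x‖ * ‖curl v x‖) := by gcongr; exact (fderiv ℝ v x).le_opNorm _
      _ = ‖fderiv ℝ v x‖ * ‖curl v x‖ ^ 2 := by ring
      _ ≤ K * (cω ^ 2 * frobeniusNormSq (fderiv ℝ v x)) :=
          mul_le_mul (hK x) (hω_sq x) (sq_nonneg _) hK0
      _ = cω ^ 2 * K * frobeniusNormSq (fderiv ℝ v x) := by ring
  have idet : Integrable (fun x => (fderiv ℝ v x).det) volume := by
    refine Integrable.mono' (hfrob_int.const_mul ((1 / 2) * K)) cdet.aestronglyMeasurable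
      (Eventually.of_forall fun x => ?_)
    rw [Real.norm_eq_abs]; exact hdet_le x
  have iP : Integrable (fun x => ⟪curl v x, fderiv ℝ v x (curl v x)⟫) volume := by
    refine Integrable.mono' (hfrob_int.const_mul (cω ^ 2 * K)) cP.aestronglyMeasurable
      (Eventually.of_forall fun x => ?_)
    rw [Real.norm_eq_abs]; exact hP_le x
  have iφP : Integrable (fun x => χ (‖v x‖ ^ 2) * ⟪curl v x, fderiv ℝ v x (curl v x)⟫) volume := by
    refine Integrable.mono' iP.norm (cφ.mul cP).aestronglyMeasurable (Eventually.of_forall fun x => ?_)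
    rw [norm_mul, Real.norm_eq_abs, abs_of_nonneg (hφ01 x).1]
    exact mul_le_of_le_one_left (norm_nonneg _) (hφ01 x).2
  have iφdet : Integrable (fun x => χ (‖v x‖ ^ 2) * (fderiv ℝ v x).det) volume := by
    refine Integrable.mono' idet.norm (cφ.mul cdet).aestronglyMeasurable (Eventually.of_forall fun x => ?_)
    rw [norm_mul, Real.norm_eq_abs, abs_of_nonneg (hφ01 x).1]
    exact mul_le_of_le_one_left (norm_nonneg _) (hφ01 x).2
  -- Step 2: split `∫ P = ∫ φ P + ∫ (1 − φ) P`, cut-off IBP on the first, Betchov on the second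
  have hIBP := integral_cutoff_mul_production_eq hv3' hB hK hv1 hv2
    (hχ.of_le (by norm_cast)) (M := 1)
    (fun s => by rw [abs_of_nonneg (hχ01 s).1]; exact (hχ01 s).2) hχD'
  have hsplit : ∫ x, ⟪curl v x, fderiv ℝ v x (curl v x)⟫ =
      (∫ x, χ (‖v x‖ ^ 2) * ⟪curl v x, fderiv ℝ v x (curl v x)⟫) +
        ∫ x, (1 - χ (‖v x‖ ^ 2)) * ⟪curl v x, fderiv ℝ v x (curl v x)⟫ := by
    rw [← integral_add iφP (iP.sub iφP |>.congr (Eventually.of_forall fun x => by simp; ring))]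
    refine integral_congr_ae (Eventually.of_forall fun x => ?_)
    simp only; ring
  -- `∫ (1 − φ) det ∇v = 0`
  have hdetφ : ∫ x, (1 - χ (‖v x‖ ^ 2)) * (fderiv ℝ v x).det = 0 := by
    have h1 : ∫ x, (fderiv ℝ v x).det = 0 := integral_det_fderiv_eq_zero hv2' hB hK hfrob_int
    have h2 : ∫ x, χ (‖v x‖ ^ 2) * (fderiv ℝ v x).det = 0 :=
      integral_comp_normSq_mul_det_eq_zero hv2' hB hK hfrob_int hχ
    have h3 : ∫ x, (1 - χ (‖v x‖ ^ 2)) * (fderiv ℝ v x).det = (∫ x, (fderiv ℝ v x).det) - ∫ x, χ (‖v x‖ ^ 2) * (fderiv ℝ v x).det := by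
      rw [← integral_sub idet iφdet]
      refine integral_congr_ae (Eventually.of_forall fun x => ?_)
      simp only; ring
    rw [h3, h1, h2, sub_zero]
  have hfastφ : ∫ x, (1 - χ (‖v x‖ ^ 2)) * ⟪curl v x, fderiv ℝ v x (curl v x)⟫ =
      ∫ x, (1 - χ (‖v x‖ ^ 2)) * (⟪curl v x, fderiv ℝ v x (curl v x)⟫ - 4 * (fderiv ℝ v x).det) := by
    have i1 : Integrable (fun x => (1 - χ (‖v x‖ ^ 2)) * ⟪curl v x, fderiv ℝ v x (curl v x)⟫) volume :=
      (iP.sub iφP).congr (Eventually.of_forall fun x => by simp only [Pi.sub_apply]; ring)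
    have i2 : Integrable (fun x => (1 - χ (‖v x‖ ^ 2)) * (4 * (fderiv ℝ v x).det)) volume :=
      ((idet.sub iφdet).const_mul 4).congr (Eventually.of_forall fun x => by simp only [Pi.sub_apply]; ring)
    have h4 : ∫ x, (1 - χ (‖v x‖ ^ 2)) * (4 * (fderiv ℝ v x).det) = 0 := by
      have : (fun x => (1 - χ (‖v x‖ ^ 2)) * (4 * (fderiv ℝ v x).det)) = fun x => 4 * ((1 - χ (‖v x‖ ^ 2)) * (fderiv ℝ v x).det) := by
        funext x; ring
      rw [this, integral_const_mul, hdetφ, mul_zero]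
    have : ∫ x, (1 - χ (‖v x‖ ^ 2)) * (⟪curl v x, fderiv ℝ v x (curl v x)⟫ - 4 * (fderiv ℝ v x).det) =
        (∫ x, (1 - χ (‖v x‖ ^ 2)) * ⟪curl v x, fderiv ℝ v x (curl v x)⟫) - ∫ x, (1 - χ (‖v x‖ ^ 2)) * (4 * (fderiv ℝ v x).det) := by
      rw [← integral_sub i1 i2]
      refine integral_congr_ae (Eventually.of_forall fun x => ?_)
      simp only; ring
    rw [this, h4, sub_zero]
  -- Step 3: the dissipative slow term and the fast-class weighted term
  have hQ := dissipative_term_le hν hv hv1 hv2 hv3 hl hχ.continuous hχ01 hχ0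
  have hRw := weighted_term_le hν hv hdiv hK hv1 hv2 hv3 hl hχ.continuous hχc' hχ01 hχ1 hχd0 hD0 hχD hm0
    hdir hp hmp
  have iRb := integrable_shell_term hv hK hv1 hχc' hχD
  have iFast : Integrable (fun x => (1 - χ (‖v x‖ ^ 2)) * (⟪curl v x, fderiv ℝ v x (curl v x)⟫ - 4 * (fderiv ℝ v x).det))
      volume :=
    ((iP.sub iφP).sub ((idet.sub iφdet).const_mul 4)).congr
      (Eventually.of_forall fun x => by simp only [Pi.sub_apply]; ring)
  have hRint := integral_add (f := fun x => -(⟪v x, curl v x⟫ *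
      (deriv χ (‖v x‖ ^ 2) * (2 * ⟪v x, fderiv ℝ v x (curl v x)⟫))))
    (g := fun x => (1 - χ (‖v x‖ ^ 2)) * (⟪curl v x, fderiv ℝ v x (curl v x)⟫ - 4 * (fderiv ℝ v x).det))
    iRb.neg iFast
  rw [integral_neg] at hRint
  -- Step 4: assemble
  have hΔ0 : 0 ≤ ∫ x, ‖(Δ v) x‖ ^ 2 := integral_nonneg fun x => sq_nonneg _
  have hνD : 0 ≤ ν * ∫ x, ‖(Δ v) x‖ ^ 2 := mul_nonneg hν.le hΔ0
  rw [hprod, hsplit, hfastφ, hIBP]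
  rw [hRint] at hRw
  linarith [hQ, hRw, hνD]

end Summit.NavierStokesRegularity.NavierStokesRegularity.Theorems.FastClassSqueeze.StreamStrain

end
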